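import Summits.Parity.GeneralizedHardyLittlewood.Theorems.BeyondDiagonalBeatsQuarter.OffDiagCoreLevelsWindow
import Summits.Parity.GeneralizedHardyLittlewood.Theorems.BeyondDiagonalBeatsQuarter.OffDiagHeartCoreSplit
import HarnessLib

/-!
# Route `PrimeLevelFamEdge`, crux K_B (stmt-Parity-20343), line `diagonal_kernel_split` rev 4, plan Ω,
# node **L7d part 2 — REDUCTION of the funded slot `hFL` of `offDiagBelowSlack_io_of_coreSplit₃` to ONE windowed family
# bound** (L7D-PLAN rev 6 §6 $; consumer of `OffDiagCoreSplitAlgebra`, W = `OffDiagCoreLevelsWindow`)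

For ANY level-free selector `D = D(Δ′, N; cell, h₁, s)` (the funded domain) and ANY conductor threshold `Rf Δ′ N ≥ 1`:

* **`coreL_eq_FL_add_UL`** — `coreL (Rf Δ′ N) (goodPrimes Δ′ N) (coreHeight ε₀) Δ′ = FL Δ′ N + UL Δ′ N` with
  `FL = coreWithW (𝟙_D·K_L)`, `UL = coreWithW (𝟙_{¬D}·K_L)` (`coreWithW_eq_add_indicator`; the slot `hLsplit`);
* **`FL_eq_win_add_tail`** — `FL = coreWin (𝟙_D·K_L) (tailHeight ε₀ N) … + coreTailW (𝟙_D·K_L) (tailHeight ε₀ N) …` (W);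
* **`hFL_of_coreWin_funded`** — if the windowed family `coreWin (𝟙_D·K_L) (tailHeight ε₀ N) (goodPrimes Δ′ N) (2N) N (coreHeight ε₀) Δ′`
  is `≤ ε·Σ ms` in absolute value eventually (every `Δ′ ∈ (1,2)`, `ε > 0`), then `FL` satisfies the funded slot `hFL`
  VERBATIM (the window tail is funded uniformly in the weight, `coreTailW_funded`).

So D5b's remaining assembly (F1–F3, $ of L7D-PLAN rev 6) has exactly ONE target: the windowed family bound for its chosen `D`.
Standard axioms; helper; closes nothing. «The programme SEARCHES and TYPES; no claim about Landau–Siegel zeros,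
Theorems 1–2 of arXiv:2211.02515 or a repaired Margin232 until a kernel theorem says so.»
-/

noncomputable section

open Finset Real Polynomial

namespace Summit.Parity.GeneralizedHardyLittlewood.Theorems.BeyondDiagonalBeatsQuarter.OffDiag

open Literature.NumberTheory.LFunctions Literature.NumberTheory.LFunctions.KMV2000
open Literature.NumberTheory.Sieve.FriedlanderIwaniecPrimes (fourier2)
open PeterssonSplit (nearBoxes)

section Reduction

variable (Dsel : ℝ → ℕ → ℕ → ℕ → ℕ → ℕ → ℕ → ℕ × ℕ → ℤ → ℤ → Prop)
  [∀ Δ' N r l m d₁ d₂ i h₁ s, Decidable (Dsel Δ' N r l m d₁ d₂ i h₁ s)] (Rf : ℝ → ℕ → ℕ)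

/-- The selected large-conductor weight `𝟙_D·K_L` is bounded by `1`. [folklore] -/
theorem norm_sel_largeKernel_le (Δ' : ℝ) (N : ℕ) (q r l m d₁ d₂ : ℕ) (i : ℕ × ℕ) (h₁ s : ℤ) :
    ‖(if Dsel Δ' N r l m d₁ d₂ i h₁ s then (1 : ℂ) else 0) *
        levelLargePart (Rf Δ' N) {q} (fun _ ↦ (1 : ℂ)) (switchMod (r + 1) s h₁)
          (switchClass (r + 1) (((l / d₁ : ℕ) : ℤ) * (m / d₂ : ℕ)) s h₁)‖ ≤ 1 := by
  rw [norm_mul]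
  have h1 : ‖(if Dsel Δ' N r l m d₁ d₂ i h₁ s then (1 : ℂ) else 0)‖ ≤ 1 := by split_ifs <;> simp
  have h2 : ‖levelLargePart (Rf Δ' N) {q} (fun _ ↦ (1 : ℂ)) (switchMod (r + 1) s h₁)
      (switchClass (r + 1) (((l / d₁ : ℕ) : ℤ) * (m / d₂ : ℕ)) s h₁)‖ ≤ 1 := by
    by_cases hh : h₁ = 0
    · have hmod : switchMod (r + 1) s h₁ = 0 := by rw [switchMod, hh, Int.zero_ediv, Int.natAbs_zero]
      have hφ : ((Nat.totient (switchMod (r + 1) s h₁) : ℂ))⁻¹ = 0 := by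
        rw [hmod, Nat.totient_zero, Nat.cast_zero, inv_zero]
      unfold levelLargePart
      rw [hφ, zero_mul, norm_zero]
      exact zero_le_one
    · haveI : NeZero (switchMod (r + 1) s h₁) := ⟨switchMod_ne_zero _ s hh⟩
      exact (norm_kernels_le (Rf Δ' N) (switchClass (r + 1) (((l / d₁ : ℕ) : ℤ) * (m / d₂ : ℕ)) s h₁)).2.2
  calc _ ≤ 1 * 1 := mul_le_mul h1 h2 (norm_nonneg _) zero_le_one
    _ = 1 := one_mul _

/-- The complementary weight `𝟙_{¬D}·K_L` is bounded by `1`. [folklore] -/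
theorem norm_unsel_largeKernel_le (Δ' : ℝ) (N : ℕ) (q r l m d₁ d₂ : ℕ) (i : ℕ × ℕ) (h₁ s : ℤ) :
    ‖(if Dsel Δ' N r l m d₁ d₂ i h₁ s then (0 : ℂ) else 1) *
        levelLargePart (Rf Δ' N) {q} (fun _ ↦ (1 : ℂ)) (switchMod (r + 1) s h₁)
          (switchClass (r + 1) (((l / d₁ : ℕ) : ℤ) * (m / d₂ : ℕ)) s h₁)‖ ≤ 1 := by
  have h := norm_sel_largeKernel_le (fun Δ' N r l m d₁ d₂ i h₁ s ↦ ¬ Dsel Δ' N r l m d₁ d₂ i h₁ s) Rf Δ' N q r l m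
    d₁ d₂ i h₁ s
  simp only [ite_not] at h
  exact h

/-- **The FL/UL split of `coreL` (slot `hLsplit`)**: for every `Δ′` and `N`,
`coreL (Rf Δ′ N) (goodPrimes Δ′ N) (coreHeight ε₀) Δ′ = coreWithW (𝟙_D·K_L) … + coreWithW (𝟙_{¬D}·K_L) …`.
[cite: KowalskiMichelVanderKam2000, §6 p. 19 — derivation] -/
theorem coreL_eq_FL_add_UL (ε₀ Δ' : ℝ) (N : ℕ) :
    coreL (Rf Δ' N) (goodPrimes Δ' N) (coreHeight ε₀) Δ' =
      coreWithW (fun q r l m d₁ d₂ i h₁ s ↦ (if Dsel Δ' N r l m d₁ d₂ i h₁ s then (1 : ℂ) else 0) *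
          levelLargePart (Rf Δ' N) {q} (fun _ ↦ (1 : ℂ)) (switchMod (r + 1) s h₁)
            (switchClass (r + 1) (((l / d₁ : ℕ) : ℤ) * (m / d₂ : ℕ)) s h₁)) (goodPrimes Δ' N) (coreHeight ε₀) Δ' +
        coreWithW (fun q r l m d₁ d₂ i h₁ s ↦ (if Dsel Δ' N r l m d₁ d₂ i h₁ s then (0 : ℂ) else 1) *
          levelLargePart (Rf Δ' N) {q} (fun _ ↦ (1 : ℂ)) (switchMod (r + 1) s h₁)
            (switchClass (r + 1) (((l / d₁ : ℕ) : ℤ) * (m / d₂ : ℕ)) s h₁)) (goodPrimes Δ' N) (coreHeight ε₀) Δ' := by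
  have hG : ∀ q ∈ goodPrimes Δ' N, 2 ≤ q := fun q hq ↦ (KMV2000.mem_goodPrimes_iff.mp hq).2.2.1.two_le
  have hK : ∀ q r l m d₁ d₂ (i : ℕ × ℕ) (h₁ s : ℤ), ‖levelLargePart (Rf Δ' N) {q} (fun _ ↦ (1 : ℂ)) (switchMod (r + 1) s h₁)
      (switchClass (r + 1) (((l / d₁ : ℕ) : ℤ) * (m / d₂ : ℕ)) s h₁)‖ ≤ 1 := by
    intro q r l m d₁ d₂ i h₁ s
    have h := norm_sel_largeKernel_le (fun _ _ _ _ _ _ _ _ _ _ ↦ True) Rf Δ' N q r l m d₁ d₂ i h₁ s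
    simpa using h
  have e1 : (fun q r l m d₁ d₂ (i : ℕ × ℕ) h₁ s ↦ (if Dsel Δ' N r l m d₁ d₂ i h₁ s then (1 : ℂ) else 0) *
          levelLargePart (Rf Δ' N) {q} (fun _ ↦ (1 : ℂ)) (switchMod (r + 1) s h₁)
            (switchClass (r + 1) (((l / d₁ : ℕ) : ℤ) * (m / d₂ : ℕ)) s h₁)) =
      fun q r l m d₁ d₂ i h₁ s ↦ if Dsel Δ' N r l m d₁ d₂ i h₁ s then
          levelLargePart (Rf Δ' N) {q} (fun _ ↦ (1 : ℂ)) (switchMod (r + 1) s h₁)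
            (switchClass (r + 1) (((l / d₁ : ℕ) : ℤ) * (m / d₂ : ℕ)) s h₁) else 0 := by
    funext q r l m d₁ d₂ i h₁ s
    split_ifs <;> simp
  have e2 : (fun q r l m d₁ d₂ (i : ℕ × ℕ) h₁ s ↦ (if Dsel Δ' N r l m d₁ d₂ i h₁ s then (0 : ℂ) else 1) *
          levelLargePart (Rf Δ' N) {q} (fun _ ↦ (1 : ℂ)) (switchMod (r + 1) s h₁)
            (switchClass (r + 1) (((l / d₁ : ℕ) : ℤ) * (m / d₂ : ℕ)) s h₁)) =
      fun q r l m d₁ d₂ i h₁ s ↦ if Dsel Δ' N r l m d₁ d₂ i h₁ s then 0 else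
          levelLargePart (Rf Δ' N) {q} (fun _ ↦ (1 : ℂ)) (switchMod (r + 1) s h₁)
            (switchClass (r + 1) (((l / d₁ : ℕ) : ℤ) * (m / d₂ : ℕ)) s h₁) := by
    funext q r l m d₁ d₂ i h₁ s
    split_ifs <;> simp
  rw [e1, e2, coreL, coreWith_eq_coreWithW]
  exact coreWithW_eq_add_indicator (Hf := coreHeight ε₀) (B := 1) (fun q r l m d₁ d₂ i h₁ s ↦ hK q r l m d₁ d₂ i h₁ s)
    (fun _ r l m d₁ d₂ i h₁ s ↦ Dsel Δ' N r l m d₁ d₂ i h₁ s) (goodPrimes Δ' N) hG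
    (fun q hq d₁ d₂ α β c i ξ₁ τ h₁ hh ↦ by
      haveI : NeZero q := ⟨by have := hG q hq; omega⟩
      exact summable_fourier2_boxWeight_intShift q d₁ d₂ α β c i ξ₁ τ hh) Δ'

/-- **FL is its windowed family plus its window tail** (leaf W), for `N ≥ 1`. [folklore] -/
theorem FL_eq_win_add_tail (ε₀ : ℝ) {Δ' : ℝ} (hΔ : 0 ≤ Δ') {N : ℕ} (hN : 1 ≤ N) :
    coreWithW (fun q r l m d₁ d₂ i h₁ s ↦ (if Dsel Δ' N r l m d₁ d₂ i h₁ s then (1 : ℂ) else 0) *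
          levelLargePart (Rf Δ' N) {q} (fun _ ↦ (1 : ℂ)) (switchMod (r + 1) s h₁)
            (switchClass (r + 1) (((l / d₁ : ℕ) : ℤ) * (m / d₂ : ℕ)) s h₁)) (goodPrimes Δ' N) (coreHeight ε₀) Δ' =
      coreWin (fun q r l m d₁ d₂ i h₁ s ↦ (if Dsel Δ' N r l m d₁ d₂ i h₁ s then (1 : ℂ) else 0) *
          levelLargePart (Rf Δ' N) {q} (fun _ ↦ (1 : ℂ)) (switchMod (r + 1) s h₁)
            (switchClass (r + 1) (((l / d₁ : ℕ) : ℤ) * (m / d₂ : ℕ)) s h₁)) (tailHeight ε₀ N) (goodPrimes Δ' N) (2 * N) N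
          (coreHeight ε₀) Δ' +
        coreTailW (fun q r l m d₁ d₂ i h₁ s ↦ (if Dsel Δ' N r l m d₁ d₂ i h₁ s then (1 : ℂ) else 0) *
          levelLargePart (Rf Δ' N) {q} (fun _ ↦ (1 : ℂ)) (switchMod (r + 1) s h₁)
            (switchClass (r + 1) (((l / d₁ : ℕ) : ℤ) * (m / d₂ : ℕ)) s h₁)) (tailHeight ε₀ N) (goodPrimes Δ' N) (2 * N)
          (coreHeight ε₀) Δ' := by
  refine coreWithW_eq_win_add_tailW (B := 1) (fun q r l m d₁ d₂ i h₁ s ↦ norm_sel_largeKernel_le Dsel Rf Δ' N q r l m d₁ d₂ i h₁ s)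
    (tailHeight ε₀ N) (goodPrimes Δ' N) hN (fun q hq ↦ ?_) (coreHeight ε₀) hΔ
  obtain ⟨h1, h2, hp, -⟩ := KMV2000.mem_goodPrimes_iff.mp hq
  exact ⟨hp.two_le, h2, by omega⟩

/-- **The funded slot `hFL` from ONE windowed family bound.** For `0 < ε₀ ≤ 1`, any level-free selector `D` and threshold
`Rf`: if for every `Δ′ ∈ (1,2)` and `ε > 0`, eventually in `N`,
`|coreWin (𝟙_D·K_L) (tailHeight ε₀ N) (goodPrimes Δ′ N) (2N) N (coreHeight ε₀) Δ′| ≤ ε·Σ_{q ∈ goodPrimes Δ′ N} ms(q)`,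
then `FL = coreWithW (𝟙_D·K_L)` satisfies `hFL` of `offDiagBelowSlack_io_of_coreSplit₃` verbatim.
[cite: KowalskiMichelVanderKam2000, §6 p. 19 — derivation] -/
theorem hFL_of_coreWin_funded {ε₀ : ℝ} (hε₀ : 0 < ε₀) (hε₁ : ε₀ ≤ 1)
    (hwin : ∀ Δ' : ℝ, 1 < Δ' → Δ' < 2 → ∀ ε : ℝ, 0 < ε → ∃ N₀ : ℕ, ∀ N : ℕ, N₀ ≤ N →
      |coreWin (fun q r l m d₁ d₂ i h₁ s ↦ (if Dsel Δ' N r l m d₁ d₂ i h₁ s then (1 : ℂ) else 0) *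
          levelLargePart (Rf Δ' N) {q} (fun _ ↦ (1 : ℂ)) (switchMod (r + 1) s h₁)
            (switchClass (r + 1) (((l / d₁ : ℕ) : ℤ) * (m / d₂ : ℕ)) s h₁)) (tailHeight ε₀ N) (goodPrimes Δ' N) (2 * N) N
          (coreHeight ε₀) Δ'| ≤ ε * ∑ q ∈ goodPrimes Δ' N, mainScaleReal Δ' q) :
    ∀ Δ' : ℝ, 1 < Δ' → Δ' < 2 → ∀ ε : ℝ, 0 < ε → ∃ N₀ : ℕ, ∀ N : ℕ, N₀ ≤ N →
      coreWithW (fun q r l m d₁ d₂ i h₁ s ↦ (if Dsel Δ' N r l m d₁ d₂ i h₁ s then (1 : ℂ) else 0) *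
          levelLargePart (Rf Δ' N) {q} (fun _ ↦ (1 : ℂ)) (switchMod (r + 1) s h₁)
            (switchClass (r + 1) (((l / d₁ : ℕ) : ℤ) * (m / d₂ : ℕ)) s h₁)) (goodPrimes Δ' N) (coreHeight ε₀) Δ' ≤
        ε * ∑ q ∈ goodPrimes Δ' N, mainScaleReal Δ' q := by
  intro Δ' h1 h2 ε hε
  obtain ⟨N₁, hN₁⟩ := hwin Δ' h1 h2 (ε / 2) (half_pos hε)
  obtain ⟨N₂, hN₂⟩ := coreTailW_funded hε₀ hε₁ Δ' h1 h2 (ε / 2) (half_pos hε)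
  refine ⟨max (max N₁ N₂) 1, fun N hN ↦ ?_⟩
  have hNN₁ : N₁ ≤ N := le_trans (le_trans (le_max_left _ _) (le_max_left _ _)) hN
  have hNN₂ : N₂ ≤ N := le_trans (le_trans (le_max_right _ _) (le_max_left _ _)) hN
  have hN1 : 1 ≤ N := le_trans (le_max_right _ _) hN
  rw [FL_eq_win_add_tail Dsel Rf ε₀ (by linarith) hN1]
  have hw := hN₁ N hNN₁
  have ht := hN₂ N hNN₂ _ (fun q r l m d₁ d₂ i h₁ s ↦ norm_sel_largeKernel_le Dsel Rf Δ' N q r l m d₁ d₂ i h₁ s)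
  have hw' := (le_abs_self _).trans hw
  have ht' := (le_abs_self _).trans ht
  linarith

end Reduction

end Summit.Parity.GeneralizedHardyLittlewood.Theorems.BeyondDiagonalBeatsQuarter.OffDiag
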